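import Summits.BirchSwinnertonDyer.BirchSwinnertonDyer.Theses.UniversalToricDescent
import Summits.BirchSwinnertonDyer.BirchSwinnertonDyer.Theorems.EisensteinPrimesHidaLimitFittingBoundConverse
import Summits.BirchSwinnertonDyer.Rank1Residual.X2.HidaLimitCongruenceAlgebra
import Literature.NumberTheory.EllipticCurves.IwasawaAlgebraHeightOneCriterionProofs
import HarnessLib

/-!
# NODE (D-0171) on crux stmt-BirchSwinnertonDyer-24207 `UniversalToricDescent.RationalSplitIMCInclusionAtThree`
# — idea `germ-recentred-tempered-heegner` (crux-ideate seat `cruxidea-stmt-BirchSwinnertonDyer-24207-1` gen 4, 2026-08-30)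

KIND: IMPLIED-BY through the EQUIV node I of gen 3 (restated verbatim; proof of `I → crux` copied verbatim from
`Cruxes/RationalSplitIMCInclusionAtThree/NodeNonsplitPatchingSaturationG3.lean` ll.113–150, commit cb86ff170400 — that
module is not yet in the farm snapshot, so it cannot be imported today).  Zero sorries, no new axiom, no named fact consumed,
`no_new_routes`.  `closes`-analogues CHECKED below (kernel, BY NAME):
* `interiorRootwise_of_germwise_of_torsion : GermwiseBoundOffTorsionAtThree → TorsionPointBoundAtThree → InteriorRootwiseBoundAtThree`
* `rationalSplitIMCInclusionAtThree_of_interiorRootwise : InteriorRootwiseBoundAtThree → UTD.RationalSplitIMCInclusionAtThree`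
* `rationalSplitIMCInclusionAtThree_of_germwise_of_torsion : GermwiseBoundOffTorsionAtThree → TorsionPointBoundAtThree → crux`.

THE MOVE (technique: ANALYTIC RE-CENTRING of the Iwasawa algebra at the interior prime under test; Kolyvagin systems
over the germ ring `R_β = 𝒪_β⟦(T−β)/3^c⟧`, Büyükboduk/Howard generality [corpus:paper:arxiv-1303.1407 p.1]).
24207 ⟺ I: `length_𝔮 X_(∅,0) ≤ ord_𝔮 L` at every INTERIOR height-one prime `𝔮 = (g) ∌ 3` of `R₀⟦T⟧`; every
`3`-power is invisible there.  Every Heegner-type supply on this crux died on ONE fact: at the wild supercuspidal prime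
there is no BOUNDED norm-compatible CM family (barrier `TraceZeroHeegnerTowerAtAdditiveSplitP`; B-g50-1 «Amice–Vélu
needs order < 1»; B-g60-1 / K1-DECISION g60 «the universal CM family has order EXACTLY 1»; this seat's B-g4-1: in the
Kirillov model `π₃|_A ≅ C_c^∞(ℚ₃^×)` of a supercuspidal `π₃` [corpus:book:bump1997-automorphic-forms-representations
p.516 L1] the norm-compatible family `(1_{1+3^mℤ₃})_m` is Kirillov-integral but costs `3^{-m}` in every
`GL₂(ℚ₃)`-stable lattice `c-Ind_J^G λ°|_A = ⊕_g c-Ind_{A∩J^g}^A λ°` (Mackey: each summand is fixed by some `U_{m_g}`, so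
`Tr = ×3` there), hence NO bounded family exists and the tempered one has order exactly 1).  Re-centring makes the
order IRRELEVANT: a distribution-valued class of ANY finite order `h` is a power series converging on the open unit disc,
hence BOUNDED on the closed disc `|T − β| ≤ |3|^c` around an interior point `β` [corpus:book:koblitz1984-p-adic-numbers-
p-adic-analysis-zeta pp.36–37 (growth vs. radius of convergence)]; so the germ `y_β ∈ 3^{-N}·H¹(K, T ⊗ 𝒪_β⟦s⟧)`,
`T = β + 3^c s`, of the tempered universal CM family is an INTEGRAL Kolyvagin system (tame Kolyvagin primes as usual)
over the 2-dimensional regular local ring `R_β = 𝒪_β⟦s⟧` with finite residue field, and the map of DVRs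
`(R₀⟦T⟧[⅓])_𝔮 → (R_β[⅓])_{(s)}` is unramified (`T − β = 3^c·s`), so RATIONAL LENGTHS AT `𝔮` ARE PRESERVED and the
cost `3^N` of shrinking the disc is paid in the currency 24207 does not see.  What remains at a non-torsion interior
`𝔮 = (T − β)·unit`: (G2) a Mazur–Rubin/Howard bound over `R_β` for a core-rank-ONE Selmer structure — with NO local
condition at the primes above 3 the structure `(∅,∅)` has core rank 2 (B-g50-2) and `(∅,0)` core rank 0, so a
rank-lowering CARTESIAN condition at ONE prime above 3 is needed for a family of NON-de-Rham twists; the candidate is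
the potentially-split (`ρ|_{G_F} = ξ ⊕ ξ^c` over the inducing ramified quadratic `F/ℚ₃` of the dihedral
supercuspidal `π₃`) Pottharst-type condition of the live card `base-doubling-tau-signs`, propagated to torsion
coefficients (cartesian defects are `3`-bounded, again invisible at `𝔮`); (G3) the germ reciprocity at the ramified
prime `𝔭`: `ord_𝔮 Log_𝔭(loc_𝔭 y_β) = ord_𝔮 𝓛_𝔭^{BDP}` — at de Rham (torsion) points this is the `p`-adic Waldspurger
formula `𝓛(χ̂) = log_{ω_f}(P^χ)`, which survives `27 ∣ N` because `f_E` is a 3-depleted overconvergent form of tame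
level `N/3^{f₃}` (`a₃ = 0`), `d⁻¹f_E` is its rigid primitive on the ordinary-canonical locus, and Colmez/Vologodsky
abelian integration agrees with Coleman's there on the `f_E`-isotypic part because `N = 0` on `D_pst(V_f)`
(potentially crystalline) — the family version off the torsion points is the research atom (no Perrin-Riou/Wach/
Kisin–Ren theory over the wild field `F`, `e(F/ℚ₃) ∈ {6,12}`).  At the TORSION-POINT primes `𝔮 ∋ (1+T)^{3^k} − 1`
(node T) the germ method is not claimed (the normalising factor of the tempered family vanishes there); the
multiplicity-zero case is classical (`𝓛(χ̂) ≠ 0 ⇒ P^χ` non-torsion ⇒ finite-layer Kolyvagin with `ρ̄₃` onto ⇒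
`Sel_(∅,0)(K, V_χ) = 0`), higher multiplicity at a finite-order character is IDEA-NEEDED.

PIECES (tags per D-0171):
* I `InteriorRootwiseBoundAtThree` — **EQUIV** (⟺ crux; gen 3, both directions kernel-checked there; `I → crux` re-checked here).
* G `GermwiseBoundOffTorsionAtThree` — **WEAKER** (= I at the interior primes containing no `(1+T)^{3^k} − 1`) · **UNDECIDED**;
  leaves: G1 ATTACKABLE (germ integrality of finite-order distribution classes + unramified DVR comparison — pure
  `p`-adic analysis / commutative algebra); G2 IDEA-NEEDED (Kolyvagin-system bound over `𝒪_β⟦s⟧` with a PROPAGATED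
  potentially-split local condition at one prime above 3; shares `base-doubling-tau-signs` K1/K2); G3 BARRIER-adjacent
  (germ reciprocity at the ramified supercuspidal prime; torsion-point case = `p`-adic Waldspurger at additive split 3,
  ATTACKABLE-with-gap); supply S INSTRUMENTABLE (order of the universal CM family along the `3`-power conductor tower:
  instrument ask D-g55-1, HOME/INBOX l.1254, UNRUN; B-g4-1 predicts «exactly 1», which this node tolerates — any finite
  order suffices).
* T `TorsionPointBoundAtThree` — **WEAKER** (= I at the countably many torsion-point primes) · **UNDECIDED**; leaves:
  T0 ATTACKABLE-with-gap (multiplicity zero), T+ IDEA-NEEDED (multiplicity ≥ 1 at a finite-order character).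
INSTRUMENT DATA CITED: none run for this node (kit_allowed = false); standing asks D-g55-1 (order of the universal
family), Q-BD-1/2 (HOME/INBOX l.1302) unchanged and UNRUN as of 2026-08-30T18:xxZ.
-/

set_option autoImplicit false
set_option linter.dupNamespace false

noncomputable section

open scoped Classical

namespace Summit.BirchSwinnertonDyer.BirchSwinnertonDyer.Cruxes.RationalSplitIMCInclusionAtThree.GermRecentredTemperedHeegner

open PowerSeries Literature.NumberTheory.EllipticCurves
  Summit.BirchSwinnertonDyer.Rank1Residual.X11b

/-- **I [EQUIV]** (verbatim restatement of gen 3's node I; same normalised signature) the ROOT-WISE form of 24207 at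
the INTERIOR height-one primes of `R₀⟦T⟧`: `Ch_Λ(X_(∅,0))·R₀⟦T⟧ ⊆ 𝔮ⁿ ⟹ (L) ⊆ 𝔮ⁿ` for every height-one `𝔮 ∌ C 3`. -/
def InteriorRootwiseBoundAtThree : Prop :=
  ∀ (W : WeierstrassCurve ℚ) [W.IsElliptic] [W.IsGloballyMinimal] (N : ℕ) [NeZero N] (K : Type) [Field K] [NumberField K] (Dt : Literature.NumberTheory.EllipticCurves.ModularForms.ModularParametrizationData W N), Summit.BirchSwinnertonDyer.Rank1Residual.Additive.ClassO6 W 3 → W.HasSurjectiveModNGaloisRep 3 → W.analyticRank = 1 → W.conductorNorm ℤ = N → Literature.NumberTheory.EllipticCurves.IsImaginaryQuadratic K → Literature.NumberTheory.EllipticCurves.SatisfiesHeegnerHypothesis N K → ∀ (κ : Literature.NumberTheory.EllipticCurves.ZpExtension K 3), κ.IsAnticyclotomic → ∀ (γ : Field.absoluteGaloisGroup K) [Fact (κ.IsTopGenerator γ)] (𝔭 : IsDedekindDomain.HeightOneSpectrum (NumberField.RingOfIntegers K)), ((3 : ℕ) : NumberField.RingOfIntegers K) ∈ 𝔭.asIdeal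 → 𝔭.asIdeal.ramificationIdx (NumberField.RingOfIntegers ℚ) = 1 → 𝔭.asIdeal.inertiaDeg (NumberField.RingOfIntegers ℚ) = 1 → ∀ (𝔭' : IsDedekindDomain.HeightOneSpectrum (NumberField.RingOfIntegers K)), ((3 : ℕ) : NumberField.RingOfIntegers K) ∈ 𝔭'.asIdeal → 𝔭' ≠ 𝔭 → ∀ (ι' : PadicAlgCl 3 ≃+* ℂ), Summit.BirchSwinnertonDyer.BirchSwinnertonDyer.Theorems.SchneiderFree.BranchInducesPrime 3 ι' 𝔭 → ∀ (ΩK : ℂ) (Ωp : ℂ_[3]) (L : Literature.NumberTheory.EllipticCurves.UnrSeries 3), ΩK ≠ 0 → Ωp ≠ 0 → Literature.NumberTheory.EllipticCurves.IsBDPLFunction ι' 𝔭 κ γ Dt.f ΩK Ωp L → Module.IsTorsion (Literature.NumberTheory.EllipticCurves.IwasawaAlgebra 3) (Summit.BirchSwinnertonDyer.Rank1Residual.X11b.AcSelmer.XAc (W.baseChange K) 3 κ 𝔭' ∅ γ) → ∀ (𝔮 : PrimeSpectrum (Literature.NumberTheory.EllipticCurves.UnrSeries 3)), 𝔮.asIdeal.height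 = 1 → PowerSeries.C ((3 : ℕ) : Literature.NumberTheory.EllipticCurves.unrIntegers 3) ∉ 𝔮.asIdeal → ∀ n : ℕ, (Summit.BirchSwinnertonDyer.Rank1Residual.X11b.AcSelmer.XAc.charIdeal (W.baseChange K) 3 κ 𝔭' ∅ γ).map (PowerSeries.map (Summit.BirchSwinnertonDyer.Rank1Residual.X11b.Halves.toUnr 3)) ≤ 𝔮.asIdeal ^ n → Ideal.span {L} ≤ 𝔮.asIdeal ^ n

/-- **G [WEAKER · UNDECIDED; leaves G1 ATTACKABLE, G2 IDEA-NEEDED, G3 BARRIER-adjacent, supply S INSTRUMENTABLE]**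
the root-wise bound at the interior height-one primes that contain NO `ω_k = (1+T)^(3^k) − 1` (no torsion point of the
anticyclotomic line): the output of the re-centred germ Kolyvagin argument. -/
def GermwiseBoundOffTorsionAtThree : Prop :=
  ∀ (W : WeierstrassCurve ℚ) [W.IsElliptic] [W.IsGloballyMinimal] (N : ℕ) [NeZero N] (K : Type) [Field K] [NumberField K] (Dt : Literature.NumberTheory.EllipticCurves.ModularForms.ModularParametrizationData W N), Summit.BirchSwinnertonDyer.Rank1Residual.Additive.ClassO6 W 3 → W.HasSurjectiveModNGaloisRep 3 → W.analyticRank = 1 → W.conductorNorm ℤ = N → Literature.NumberTheory.EllipticCurves.IsImaginaryQuadratic K → Literature.NumberTheory.EllipticCurves.SatisfiesHeegnerHypothesis N K → ∀ (κ : Literature.NumberTheory.EllipticCurves.ZpExtension K 3), κ.IsAnticyclotomic → ∀ (γ : Field.absoluteGaloisGroup K) [Fact (κ.IsTopGenerator γ)] (𝔭 : IsDedekindDomain.HeightOneSpectrum (NumberField.RingOfIntegers K)), ((3 : ℕ) : NumberField.RingOfIntegers K) ∈ 𝔭.asIdeal → 𝔭.asIdeal.ramificationIdx (NumberField.RingOfIntegers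 ℚ) = 1 → 𝔭.asIdeal.inertiaDeg (NumberField.RingOfIntegers ℚ) = 1 → ∀ (𝔭' : IsDedekindDomain.HeightOneSpectrum (NumberField.RingOfIntegers K)), ((3 : ℕ) : NumberField.RingOfIntegers K) ∈ 𝔭'.asIdeal → 𝔭' ≠ 𝔭 → ∀ (ι' : PadicAlgCl 3 ≃+* ℂ), Summit.BirchSwinnertonDyer.BirchSwinnertonDyer.Theorems.SchneiderFree.BranchInducesPrime 3 ι' 𝔭 → ∀ (ΩK : ℂ) (Ωp : ℂ_[3]) (L : Literature.NumberTheory.EllipticCurves.UnrSeries 3), ΩK ≠ 0 → Ωp ≠ 0 → Literature.NumberTheory.EllipticCurves.IsBDPLFunction ι' 𝔭 κ γ Dt.f ΩK Ωp L → Module.IsTorsion (Literature.NumberTheory.EllipticCurves.IwasawaAlgebra 3) (Summit.BirchSwinnertonDyer.Rank1Residual.X11b.AcSelmer.XAc (W.baseChange K) 3 κ 𝔭' ∅ γ) → ∀ (𝔮 : PrimeSpectrum (Literature.NumberTheory.EllipticCurves.UnrSeries 3)), 𝔮.asIdeal.height = 1 → PowerSeries.C ((3 : ℕ) : Literature.NumberTheory.EllipticCurves.unrIntegers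 3) ∉ 𝔮.asIdeal → (∀ k : ℕ, ((1 + PowerSeries.X : Literature.NumberTheory.EllipticCurves.UnrSeries 3) ^ (3 ^ k) - 1) ∉ 𝔮.asIdeal) → ∀ n : ℕ, (Summit.BirchSwinnertonDyer.Rank1Residual.X11b.AcSelmer.XAc.charIdeal (W.baseChange K) 3 κ 𝔭' ∅ γ).map (PowerSeries.map (Summit.BirchSwinnertonDyer.Rank1Residual.X11b.Halves.toUnr 3)) ≤ 𝔮.asIdeal ^ n → Ideal.span {L} ≤ 𝔮.asIdeal ^ n

/-- **T [WEAKER · UNDECIDED; leaves T0 ATTACKABLE-with-gap (multiplicity zero: `p`-adic Waldspurger at additive split 3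
+ finite-layer Kolyvagin), T+ IDEA-NEEDED (higher multiplicity at a finite-order character)]** the root-wise bound at
the torsion-point primes `𝔮 ∋ (1+T)^(3^k) − 1`. -/
def TorsionPointBoundAtThree : Prop :=
  ∀ (W : WeierstrassCurve ℚ) [W.IsElliptic] [W.IsGloballyMinimal] (N : ℕ) [NeZero N] (K : Type) [Field K] [NumberField K] (Dt : Literature.NumberTheory.EllipticCurves.ModularForms.ModularParametrizationData W N), Summit.BirchSwinnertonDyer.Rank1Residual.Additive.ClassO6 W 3 → W.HasSurjectiveModNGaloisRep 3 → W.analyticRank = 1 → W.conductorNorm ℤ = N → Literature.NumberTheory.EllipticCurves.IsImaginaryQuadratic K → Literature.NumberTheory.EllipticCurves.SatisfiesHeegnerHypothesis N K → ∀ (κ : Literature.NumberTheory.EllipticCurves.ZpExtension K 3), κ.IsAnticyclotomic → ∀ (γ : Field.absoluteGaloisGroup K) [Fact (κ.IsTopGenerator γ)] (𝔭 : IsDedekindDomain.HeightOneSpectrum (NumberField.RingOfIntegers K)), ((3 : ℕ) : NumberField.RingOfIntegers K) ∈ 𝔭.asIdeal → 𝔭.asIdeal.ramificationIdx (NumberField.RingOfIntegers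 ℚ) = 1 → 𝔭.asIdeal.inertiaDeg (NumberField.RingOfIntegers ℚ) = 1 → ∀ (𝔭' : IsDedekindDomain.HeightOneSpectrum (NumberField.RingOfIntegers K)), ((3 : ℕ) : NumberField.RingOfIntegers K) ∈ 𝔭'.asIdeal → 𝔭' ≠ 𝔭 → ∀ (ι' : PadicAlgCl 3 ≃+* ℂ), Summit.BirchSwinnertonDyer.BirchSwinnertonDyer.Theorems.SchneiderFree.BranchInducesPrime 3 ι' 𝔭 → ∀ (ΩK : ℂ) (Ωp : ℂ_[3]) (L : Literature.NumberTheory.EllipticCurves.UnrSeries 3), ΩK ≠ 0 → Ωp ≠ 0 → Literature.NumberTheory.EllipticCurves.IsBDPLFunction ι' 𝔭 κ γ Dt.f ΩK Ωp L → Module.IsTorsion (Literature.NumberTheory.EllipticCurves.IwasawaAlgebra 3) (Summit.BirchSwinnertonDyer.Rank1Residual.X11b.AcSelmer.XAc (W.baseChange K) 3 κ 𝔭' ∅ γ) → ∀ (𝔮 : PrimeSpectrum (Literature.NumberTheory.EllipticCurves.UnrSeries 3)), 𝔮.asIdeal.height = 1 → PowerSeries.C ((3 : ℕ) : Literature.NumberTheory.EllipticCurves.unrIntegers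 3) ∉ 𝔮.asIdeal → (∃ k : ℕ, ((1 + PowerSeries.X : Literature.NumberTheory.EllipticCurves.UnrSeries 3) ^ (3 ^ k) - 1) ∈ 𝔮.asIdeal) → ∀ n : ℕ, (Summit.BirchSwinnertonDyer.Rank1Residual.X11b.AcSelmer.XAc.charIdeal (W.baseChange K) 3 κ 𝔭' ∅ γ).map (PowerSeries.map (Summit.BirchSwinnertonDyer.Rank1Residual.X11b.Halves.toUnr 3)) ≤ 𝔮.asIdeal ^ n → Ideal.span {L} ≤ 𝔮.asIdeal ^ n

/-- **Composition into the EQUIV node (kernel): G ∧ T ⟹ I** (dichotomy on whether `𝔮` contains some `ω_k`). -/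
theorem interiorRootwise_of_germwise_of_torsion
    (hG : GermwiseBoundOffTorsionAtThree) (hT : TorsionPointBoundAtThree) : InteriorRootwiseBoundAtThree := by
  intro W _ _ N _ K _ _ Dt hO6 hsurj hr1 hN hK hH κ hκ γ _ 𝔭 h𝔭 he hf 𝔭' h𝔭' hne ι' hι ΩK Ωp L hΩK hΩp hL htor
    𝔮 h𝔮 h3 n hn
  by_cases hω : ∃ k : ℕ, ((1 + PowerSeries.X : Literature.NumberTheory.EllipticCurves.UnrSeries 3) ^ (3 ^ k) - 1)
      ∈ 𝔮.asIdeal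
  · exact hT W N K Dt hO6 hsurj hr1 hN hK hH κ hκ γ 𝔭 h𝔭 he hf 𝔭' h𝔭' hne ι' hι ΩK Ωp L hΩK hΩp hL htor 𝔮 h𝔮 h3
      hω n hn
  · simp only [not_exists] at hω
    exact hG W N K Dt hO6 hsurj hr1 hN hK hH κ hκ γ 𝔭 h𝔭 he hf 𝔭' h𝔭' hne ι' hι ΩK Ωp L hΩK hΩp hL htor 𝔮 h𝔮 h3
      hω n hn

/-- `3` is a prime element of `R₀ = unrIntegers 3` (a DVR with uniformiser `3`). -/
theorem prime_three_unrIntegers : Prime ((3 : ℕ) : unrIntegers 3) := by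
  haveI := Summit.BirchSwinnertonDyer.Rank1Residual.X2.HidaLimitAlgebra.isDiscreteValuationRing_unrIntegers (p := 3)
  exact (Summit.BirchSwinnertonDyer.Rank1Residual.X2.HidaLimitAlgebra.irreducible_natCast_p (p := 3)).prime

/-- The extended characteristic ideal is principal: `Ch_Λ(X)·R₀⟦T⟧ = (F)` for some `F`. -/
theorem exists_map_charIdeal_eq_span {K : Type} [Field K] [NumberField K] (W : WeierstrassCurve K)
    (κ : ZpExtension K 3) (𝔭' : IsDedekindDomain.HeightOneSpectrum (NumberField.RingOfIntegers K))
    (γ : Field.absoluteGaloisGroup K) [Fact (κ.IsTopGenerator γ)] :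
    ∃ F : UnrSeries 3, (AcSelmer.XAc.charIdeal W 3 κ 𝔭' ∅ γ).map (PowerSeries.map (Halves.toUnr 3)) =
      Ideal.span {F} := by
  obtain ⟨f, hf⟩ := (charIdeal_isPrincipal_holds 3 (AcSelmer.XAc W 3 κ 𝔭' ∅ γ)).principal
  refine ⟨PowerSeries.map (Halves.toUnr 3) f, ?_⟩
  have hf' : AcSelmer.XAc.charIdeal W 3 κ 𝔭' ∅ γ = Ideal.span {f} := by
    change Literature.NumberTheory.EllipticCurves.Module.charIdeal (IwasawaAlgebra 3) (AcSelmer.XAc W 3 κ 𝔭' ∅ γ) =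
      Ideal.span {f}
    simpa [Ideal.submodule_span_eq] using hf
  rw [hf', Ideal.map_span, Set.image_singleton]

/-- **EQUIV node, direction used by the line (kernel): I ⟹ 24207.**  Principality of `Ch_Λ·R₀⟦T⟧` + the tree's
height-one criterion over the UFD `R₀⟦T⟧` with `π₀ = C 3`; off the torsion locus `Ch = ⊤` and `k = 0`. -/
theorem rationalSplitIMCInclusionAtThree_of_interiorRootwise (hI : InteriorRootwiseBoundAtThree) :
    Summit.BirchSwinnertonDyer.BirchSwinnertonDyer.Theses.UniversalToricDescent.RationalSplitIMCInclusionAtThree := by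
  intro W _ _ N _ K _ _ Dt hO6 hsurj hr1 hN hK hH κ hκ γ _ 𝔭 h𝔭 he hf 𝔭' h𝔭' hne ι' hι ΩK Ωp L hΩK hΩp hL
  by_cases htor : Module.IsTorsion (IwasawaAlgebra 3) (AcSelmer.XAc (W.baseChange K) 3 κ 𝔭' ∅ γ)
  · obtain ⟨F, hF⟩ := exists_map_charIdeal_eq_span (W.baseChange K) κ 𝔭' γ
    have h := hI W N K Dt hO6 hsurj hr1 hN hK hH κ hκ γ 𝔭 h𝔭 he hf 𝔭' h𝔭' hne ι' hι ΩK Ωp L hΩK hΩp hL htor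
    haveI := Summit.BirchSwinnertonDyer.Rank1Residual.X2.HidaLimitAlgebra.isDiscreteValuationRing_unrIntegers (p := 3)
    obtain ⟨k, hk⟩ := PowerSeries.exists_C_pow_mul_mem_span_of_forall_heightOne prime_three_unrIntegers F
      (Ideal.span {L}) (fun 𝔮 h𝔮 h3 n hn => h 𝔮 h𝔮 h3 n (by rw [hF]; exact hn))
    refine ⟨k, ?_⟩
    have h3 : ((3 : ℕ) : UnrSeries 3) = C ((3 : ℕ) : unrIntegers 3) := (map_natCast C 3).symm
    rw [hF, h3, ← map_pow]
    exact hk L (Ideal.mem_span_singleton_self L)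
  · refine ⟨0, ?_⟩
    have htop : AcSelmer.XAc.charIdeal (W.baseChange K) 3 κ 𝔭' ∅ γ = ⊤ :=
      Summit.BirchSwinnertonDyer.BirchSwinnertonDyer.Theorems.charIdeal_eq_top_of_not_isTorsion (p := 3) _ htor
    rw [htop, Ideal.map_top]; exact Submodule.mem_top

/-- **The idea's composition (kernel, BY NAME): G ∧ T ⟹ 24207.** -/
theorem rationalSplitIMCInclusionAtThree_of_germwise_of_torsion
    (hG : GermwiseBoundOffTorsionAtThree) (hT : TorsionPointBoundAtThree) :
    Summit.BirchSwinnertonDyer.BirchSwinnertonDyer.Theses.UniversalToricDescent.RationalSplitIMCInclusionAtThree :=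
  rationalSplitIMCInclusionAtThree_of_interiorRootwise (interiorRootwise_of_germwise_of_torsion hG hT)

end Summit.BirchSwinnertonDyer.BirchSwinnertonDyer.Cruxes.RationalSplitIMCInclusionAtThree.GermRecentredTemperedHeegner

end
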